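import Summits.HodgeConjecture.HodgeConjecture.Theorems.Ring2WeilCoverageCMFieldAllPrimesM
import Summits.HodgeConjecture.HodgeConjecture.Theorems.Ring2WeilCoverageCMFieldZeta7RationalRows
import Summits.HodgeConjecture.HodgeConjecture.Theorems.Ring2WeilCoverageCMFieldZeta9RationalRows
import Summits.HodgeConjecture.HodgeConjecture.Theorems.Ring2WeilCoverageCMFieldCompositeSexticCarriers
import HarnessLib

/-!
# Ring 2 — Weil-type family-coverage census, CM-field rows (X-AI): the INTEGER rows of the sextic (`g = 12`,
# `(3,2)`) tables in closed form — `[n] = [1] ⟺ every prime inert in `K` divides `n` to an even power`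

HONEST FRAMING: research route conditional on HC_CM; not a corollary; Q11.4-sentence-2 already refuted in dim ≥ 3.

Cell `pub-hodge-ring2`, seat `ring2-b03` (gen 60), census `HOME/WEIL-FAMILY-COVERAGE.md` «## b03» (b03.23/b03.24:
the `g = 12` CM-field tables, `E` sextic CM `⊇ K` imaginary quadratic, `F = E⁺` cubic, components `W12.E.δ` indexed by
`δ ∈ F^×/Nm_{E/F}(E^×)`, split class `[(-1)²] = [1]`). Part X-AC classified the RATIONAL rows
(`[q] = [1] ⟺ q ∈ N_{K/ℚ}(K^×)`) and parts X-AA / X-AB / X-AE the class of every PRIME; here the generic integer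
classification of part IX-M (`natCast_eq_split_iff_even`, `natCast_mk_eq_mk_iff_even`: a prime classification plus
cofactor obstructions `[ℓ·w] ≠ [1]` off the split type give `[n] = [1] ⟺` the non-split primes divide `n` to even
powers) is fed with those prime rows. GENERIC (§0, any carrier `R` of ODD degree with `t ∈ F`, `σt² = −c₀`):
`mk_prime_mul_ne_split_of_neg_one` / `…_of_neg_three` (the cofactor obstructions for `K = ℚ(i)`, `ℚ(√−3)`:
`ℓ·w = x² + y²`, resp. `x² + 3y²`, over `ℚ` with `ℓ ≡ 3 (4)`, resp. `ℓ ≡ 2 (3)`, `ℓ ∤ w`, is impossible by part X-Z's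
descent — the dyadic case of `x² + 3y²` through the anisotropic form `u² + uv + v²`), and
**`natCast_eq_split_iff_of_neg_one`: `[n] = [1] ⟺ every prime `ℓ ≡ 3 (mod 4)` divides `n` to an even power**,
**`natCast_eq_split_iff_of_neg_three`: `⟺ every prime `ℓ ≡ 2 (mod 3)` divides `n` to an even power**, with the
row structures `natCast_mk_eq_mk_iff_of_neg_one/three` (`[n₁] = [n₂] ⟺` equal parities at those primes).
INSTANCES (§1–§3): `ℚ(ζ₇) ⊇ ℚ(√−7)` (`R = S³+7S²+14S+7`; primes `ℓ ≡ 3, 5, 6 (mod 7)`; parts X-AA), `ℚ(ζ₉) ⊇ ℚ(√−3)`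
(`R = S³+6S²+9S+3`), and the composite carriers `ℚ(ζ₇)⁺(i)` (`R₂₈ = S³+5S²+6S+1`), `ℚ(ζ₉)⁺(i)` (`R₃₆ = S³+6S²+9S+1`)
of part X-AE; the carriers `ℚ(ζ₇)⁺(√−3)` (`R₂₁`) and `F₁₄₈(i)` (`R₁₄₈`) of parts X-AF/X-AG are covered by §0 verbatim
(one line each once their `t` is imported). So for every `n ≥ 1` the component `W12.E.[n]` of each sextic census
table is decided: `n ↦ {ℓ inert in K : ℓ ∥^{odd} n}` is a complete invariant of `[n]`, as the tabulated `T(n)`,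
`n ≤ 40`, of b03.23 (kit j209882) say.

THEOREMS ONLY: no `def`, no named fact, no `sorry`; `HC_CM` does not occur; nothing about the Hodge conjecture is
asserted (index-set structure only; the general member of every row is OPEN, crux stmt-1076 untouched).
References: [Deligne1982HodgeCycles] §4 p. 30 (1), Cor. 4.2, Lemma 4.6; [Landherr1936HermitianForms]; [Cox2013] §1 (1.1). -/

noncomputable section

set_option linter.dupNamespace false

open Polynomial

namespace Summit.HodgeConjecture.HodgeConjecture.Ring2.WeilCoverageCM

open Literature.AlgebraicGeometry.Deligne1982
open Literature.AlgebraicGeometry.HodgeTheory (splitDiscriminantClassCM)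
open Literature.NumberTheory.QuadraticFields.Quadratic (legendreSym_neg_three_eq_one_iff exists_eq_sq_add_three_mul_sq_iff)

/-! ### §0 Generic: odd-degree carriers containing `ℚ(i)` or `ℚ(√−3)` -/

section Generic

variable {R : Polynomial ℤ} [Fact (Irreducible (realPolyQ R))] [Fact (Irreducible (cmPolyQ R))]

/-- **Cofactor obstruction, `K = ℚ(i)`**: on a carrier of odd degree with `σt² = −1` (`E ⊇ ℚ(i)`), for every prime
`ℓ ≡ 3 (mod 4)` and `ℓ ∤ w`: `[ℓ·w] ≠ [(−1)²] = [1]` — else `ℓw = x² + y²` over `ℚ` (part X-AC), impossible since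
`x² + y²` is anisotropic mod `ℓ` (part X-Z descent). [cite: Deligne1982HodgeCycles, §4 p. 30 (1) and Cor. 4.2] -/
theorem mk_prime_mul_ne_split_of_neg_one (hodd : Odd R.natDegree) (t : realField R)
    (ht : AdjoinRoot.root (realPolyQ R) * t ^ 2 = AdjoinRoot.of (realPolyQ R) (-1)) {ℓ : ℕ} (hℓ : ℓ.Prime)
    (h4 : ℓ % 4 = 3) (w : ℤ) (hw : ¬ (ℓ : ℤ) ∣ w) (q : (realField R)ˣ)
    (hq : (q : realField R) = AdjoinRoot.of (realPolyQ R) ((ℓ : ℚ) * w)) :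
    (QuotientGroup.mk q : cmNormResidueGroup R) ≠ splitDiscriminantClassCM R 2 := by
  intro h
  obtain ⟨x, y, hxy⟩ := (mk_eq_splitDiscriminantClassCM_two_iff_of_odd hodd one_pos t ht q hq).1 h
  haveI := Fact.mk hℓ
  have hns : ¬ IsSquare ((-1 : ℤ) : ZMod ℓ) := by
    rw [Int.cast_neg, Int.cast_one, ZMod.exists_sq_eq_neg_one_iff]
    exact fun h' => h' h4
  exact prime_mul_ne_binaryForm hℓ 0 1 (aniso_sq_add_mul_sq_of_not_isSquare 1 hns) w hw x y
    (by push_cast; linear_combination hxy)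

/-- **Cofactor obstruction, `K = ℚ(√−3)`**: on a carrier of odd degree with `σt² = −3` (`E ⊇ ℚ(√−3)`), for every
prime `ℓ ≡ 2 (mod 3)` — the prime `2` INCLUDED — and `ℓ ∤ w`: `[ℓ·w] ≠ [1]` — else `ℓw = x² + 3y²` over `ℚ`;
for odd `ℓ` the form is anisotropic mod `ℓ` (`(−3/ℓ) = −1`), for `ℓ = 2` one passes to `u² + uv + v²`
(`u = x + y`, `v = −2y`), anisotropic mod `2` (part X-AB's dyadic argument made generic).
[cite: Deligne1982HodgeCycles, §4 p. 30 (1) and Cor. 4.2] [cite: Cox2013, §1 (1.1)] -/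
theorem mk_prime_mul_ne_split_of_neg_three (hodd : Odd R.natDegree) (t : realField R)
    (ht : AdjoinRoot.root (realPolyQ R) * t ^ 2 = AdjoinRoot.of (realPolyQ R) (-3)) {ℓ : ℕ} (hℓ : ℓ.Prime)
    (h3 : ℓ % 3 = 2) (w : ℤ) (hw : ¬ (ℓ : ℤ) ∣ w) (q : (realField R)ˣ)
    (hq : (q : realField R) = AdjoinRoot.of (realPolyQ R) ((ℓ : ℚ) * w)) :
    (QuotientGroup.mk q : cmNormResidueGroup R) ≠ splitDiscriminantClassCM R 2 := by
  intro h
  obtain ⟨x, y, hxy⟩ :=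
    (mk_eq_splitDiscriminantClassCM_two_iff_of_odd hodd (by norm_num : (0 : ℚ) < 3) t ht q hq).1 h
  by_cases hℓ2 : ℓ = 2
  · subst hℓ2
    exact prime_mul_ne_binaryForm Nat.prime_two 1 1 aniso_two_sq_add_mul_add_sq w hw (x + y) (-2 * y)
      (by push_cast; linear_combination hxy)
  · haveI := Fact.mk hℓ
    have hℓ3 : ℓ ≠ 3 := by omega
    have h0 : ((-3 : ℤ) : ZMod ℓ) ≠ 0 := by
      intro h0
      rw [Int.cast_neg, neg_eq_zero, ZMod.intCast_zmod_eq_zero_iff_dvd] at h0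
      exact hℓ3 ((Nat.prime_dvd_prime_iff_eq hℓ (by norm_num)).1 (by exact_mod_cast h0))
    have hns : ¬ IsSquare ((-3 : ℤ) : ZMod ℓ) := by
      rw [← legendreSym.eq_neg_one_iff (p := ℓ)]
      rcases legendreSym.eq_one_or_neg_one ℓ h0 with h1 | h1
      · rw [legendreSym_neg_three_eq_one_iff hℓ2 hℓ3] at h1
        omega
      · exact h1
    exact prime_mul_ne_binaryForm hℓ 0 3 (aniso_sq_add_mul_sq_of_not_isSquare 3 hns) w hw x y
      (by push_cast; linear_combination hxy)

/-- **Split primes, `K = ℚ(√−3)`**: on a carrier of odd degree with `σt² = −3`, `[ℓ] = [1]` for `ℓ = 3` and every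
prime `ℓ ≡ 1 (mod 3)` (`ℓ = x² + 3y²`, Fermat). [cite: Cox2013, §1 (1.1)] [cite: Deligne1982HodgeCycles, §4 Cor. 4.2] -/
theorem mk_prime_eq_split_of_neg_three (hodd : Odd R.natDegree) (t : realField R)
    (ht : AdjoinRoot.root (realPolyQ R) * t ^ 2 = AdjoinRoot.of (realPolyQ R) (-3)) {ℓ : ℕ} (hℓ : ℓ.Prime)
    (h3 : ℓ = 3 ∨ ℓ % 3 = 1) (q : (realField R)ˣ) (hq : (q : realField R) = AdjoinRoot.of (realPolyQ R) (ℓ : ℚ)) :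
    (QuotientGroup.mk q : cmNormResidueGroup R) = splitDiscriminantClassCM R 2 := by
  have _h := hodd
  have hℓ2 : ℓ ≠ 2 := by omega
  obtain ⟨x, y, hxy⟩ := (exists_eq_sq_add_three_mul_sq_iff hℓ hℓ2).2 h3
  exact mk_eq_splitDiscriminantClassCM_two_of_sq_add_mul_sq t ht x y q (by rw [hq]; congr 1; exact_mod_cast hxy)

/-- **INTEGER ROWS, `K = ℚ(i)`: `[n] = [1] ⟺ every prime `ℓ ≡ 3 (mod 4)` divides `n` to an even power** (`n ≥ 1`;
odd-degree carrier with `σt² = −1`). [cite: Deligne1982HodgeCycles, §4 p. 30 (1) and Cor. 4.2] [cite: Landherr1936HermitianForms] -/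
theorem natCast_eq_split_iff_of_neg_one (hodd : Odd R.natDegree) (t : realField R)
    (ht : AdjoinRoot.root (realPolyQ R) * t ^ 2 = AdjoinRoot.of (realPolyQ R) (-1))
    (n : ℕ) (hn : 1 ≤ n) (v : (realField R)ˣ) (hv : (v : realField R) = n) :
    (QuotientGroup.mk v : cmNormResidueGroup R) = splitDiscriminantClassCM R 2 ↔
      ∀ ℓ : ℕ, ℓ.Prime → ℓ % 4 = 3 → Even (n.factorization ℓ) := by
  refine (natCast_eq_split_iff_even (fun ℓ => ℓ % 4 ≠ 3) 1 ?_ (fun h => absurd h Nat.not_prime_one) ?_ n hn v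
    hv).trans (forall_congr' fun ℓ => forall_congr' fun _ => by simp only [ne_eq, not_not])
  · intro ℓ hℓ hs u hu
    have h' : ℓ = 2 ∨ ℓ % 4 = 1 := by
      rcases hℓ.eq_two_or_odd' with h2 | ho
      · exact Or.inl h2
      · have := Nat.odd_iff.mp ho
        right; omega
    exact (mk_prime_eq_split_iff_of_neg_one hodd t ht hℓ u (by rw [hu, map_natCast])).2 h'
  · intro ℓ hℓ hs _ w hw u hu
    exact mk_prime_mul_ne_split_of_neg_one hodd t ht hℓ (by simpa using hs) w hw u hu

/-- **ROW STRUCTURE, `K = ℚ(i)`: `[n₁] = [n₂] ⟺ every prime `ℓ ≡ 3 (mod 4)` occurs in `n₁`, `n₂` with exponents of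
the same parity.** [cite: Deligne1982HodgeCycles, §4 p. 30 (1) and Cor. 4.2] [cite: Landherr1936HermitianForms] -/
theorem natCast_mk_eq_mk_iff_of_neg_one (hodd : Odd R.natDegree) (t : realField R)
    (ht : AdjoinRoot.root (realPolyQ R) * t ^ 2 = AdjoinRoot.of (realPolyQ R) (-1))
    {n₁ n₂ : ℕ} (hn₁ : 1 ≤ n₁) (hn₂ : 1 ≤ n₂) (u v : (realField R)ˣ)
    (hu : (u : realField R) = n₁) (hv : (v : realField R) = n₂) :
    (QuotientGroup.mk u : cmNormResidueGroup R) = QuotientGroup.mk v ↔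
      ∀ ℓ : ℕ, ℓ.Prime → ℓ % 4 = 3 → (Even (n₁.factorization ℓ) ↔ Even (n₂.factorization ℓ)) := by
  refine (natCast_mk_eq_mk_iff_even (fun ℓ => ℓ % 4 ≠ 3) 1 ?_ (fun h => absurd h Nat.not_prime_one) ?_ hn₁ hn₂
    u v hu hv).trans (forall_congr' fun ℓ => forall_congr' fun _ => by simp only [ne_eq, not_not])
  · intro ℓ hℓ hs u hu
    have h' : ℓ = 2 ∨ ℓ % 4 = 1 := by
      rcases hℓ.eq_two_or_odd' with h2 | ho
      · exact Or.inl h2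
      · have := Nat.odd_iff.mp ho
        right; omega
    exact (mk_prime_eq_split_iff_of_neg_one hodd t ht hℓ u (by rw [hu, map_natCast])).2 h'
  · intro ℓ hℓ hs _ w hw u hu
    exact mk_prime_mul_ne_split_of_neg_one hodd t ht hℓ (by simpa using hs) w hw u hu

/-- **INTEGER ROWS, `K = ℚ(√−3)`: `[n] = [1] ⟺ every prime `ℓ ≡ 2 (mod 3)` divides `n` to an even power**
(`n ≥ 1`; odd-degree carrier with `σt² = −3`). [cite: Deligne1982HodgeCycles, §4 p. 30 (1) and Cor. 4.2] [cite: Landherr1936HermitianForms] -/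
theorem natCast_eq_split_iff_of_neg_three (hodd : Odd R.natDegree) (t : realField R)
    (ht : AdjoinRoot.root (realPolyQ R) * t ^ 2 = AdjoinRoot.of (realPolyQ R) (-3))
    (n : ℕ) (hn : 1 ≤ n) (v : (realField R)ˣ) (hv : (v : realField R) = n) :
    (QuotientGroup.mk v : cmNormResidueGroup R) = splitDiscriminantClassCM R 2 ↔
      ∀ ℓ : ℕ, ℓ.Prime → ℓ % 3 = 2 → Even (n.factorization ℓ) := by
  refine (natCast_eq_split_iff_even (fun ℓ => ℓ % 3 ≠ 2) 1 ?_ (fun h => absurd h Nat.not_prime_one) ?_ n hn v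
    hv).trans (forall_congr' fun ℓ => forall_congr' fun _ => by simp only [ne_eq, not_not])
  · intro ℓ hℓ hs u hu
    have h' : ℓ = 3 ∨ ℓ % 3 = 1 := by
      by_cases h0 : ℓ % 3 = 0
      · left
        rcases (Nat.dvd_prime hℓ).1 (Nat.dvd_of_mod_eq_zero h0) with h' | h' <;> omega
      · right; omega
    exact mk_prime_eq_split_of_neg_three hodd t ht hℓ h' u (by rw [hu, map_natCast])
  · intro ℓ hℓ hs _ w hw u hu
    exact mk_prime_mul_ne_split_of_neg_three hodd t ht hℓ (by simpa using hs) w hw u hu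

/-- **ROW STRUCTURE, `K = ℚ(√−3)`: `[n₁] = [n₂] ⟺ every prime `ℓ ≡ 2 (mod 3)` occurs in `n₁`, `n₂` with exponents
of the same parity.** [cite: Deligne1982HodgeCycles, §4 p. 30 (1) and Cor. 4.2] [cite: Landherr1936HermitianForms] -/
theorem natCast_mk_eq_mk_iff_of_neg_three (hodd : Odd R.natDegree) (t : realField R)
    (ht : AdjoinRoot.root (realPolyQ R) * t ^ 2 = AdjoinRoot.of (realPolyQ R) (-3))
    {n₁ n₂ : ℕ} (hn₁ : 1 ≤ n₁) (hn₂ : 1 ≤ n₂) (u v : (realField R)ˣ)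
    (hu : (u : realField R) = n₁) (hv : (v : realField R) = n₂) :
    (QuotientGroup.mk u : cmNormResidueGroup R) = QuotientGroup.mk v ↔
      ∀ ℓ : ℕ, ℓ.Prime → ℓ % 3 = 2 → (Even (n₁.factorization ℓ) ↔ Even (n₂.factorization ℓ)) := by
  refine (natCast_mk_eq_mk_iff_even (fun ℓ => ℓ % 3 ≠ 2) 1 ?_ (fun h => absurd h Nat.not_prime_one) ?_ hn₁ hn₂
    u v hu hv).trans (forall_congr' fun ℓ => forall_congr' fun _ => by simp only [ne_eq, not_not])
  · intro ℓ hℓ hs u hu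
    have h' : ℓ = 3 ∨ ℓ % 3 = 1 := by
      by_cases h0 : ℓ % 3 = 0
      · left
        rcases (Nat.dvd_prime hℓ).1 (Nat.dvd_of_mod_eq_zero h0) with h' | h' <;> omega
      · right; omega
    exact mk_prime_eq_split_of_neg_three hodd t ht hℓ h' u (by rw [hu, map_natCast])
  · intro ℓ hℓ hs _ w hw u hu
    exact mk_prime_mul_ne_split_of_neg_three hodd t ht hℓ (by simpa using hs) w hw u hu

end Generic

/-! ### §1 `E = ℚ(ζ₇) ⊇ K = ℚ(√−7)`: `R = S³ + 7S² + 14S + 7` -/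

section Zeta7

variable {R : Polynomial ℤ} (hR : R = X ^ 3 + C 7 * X ^ 2 + C 14 * X + C 7) [Fact (Irreducible (realPolyQ R))]
  [Fact (Irreducible (cmPolyQ R))]
include hR

/-- **`ℚ(ζ₇)`: `[n] = [1] ⟺ every prime `ℓ ≡ 3, 5, 6 (mod 7)` divides `n` to an even power** (`n ≥ 1`; prime rows
and cofactor obstructions from part X-AA). Table b03.23 (kit j209882): `[2] = [7] = [11] = [1]`, `[3], [5], [6], [13] ≠ [1]`
— instances. [cite: Deligne1982HodgeCycles, §4 p. 30 (1) and Cor. 4.2] [cite: Landherr1936HermitianForms] -/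
theorem zeta7_natCast_eq_split_iff (n : ℕ) (hn : 1 ≤ n) (v : (realField R)ˣ) (hv : (v : realField R) = n) :
    (QuotientGroup.mk v : cmNormResidueGroup R) = splitDiscriminantClassCM R 2 ↔
      ∀ ℓ : ℕ, ℓ.Prime → (ℓ % 7 = 3 ∨ ℓ % 7 = 5 ∨ ℓ % 7 = 6) → Even (n.factorization ℓ) := by
  refine (natCast_eq_split_iff_even (fun ℓ => ¬ (ℓ % 7 = 3 ∨ ℓ % 7 = 5 ∨ ℓ % 7 = 6)) 1 ?_
    (fun h => absurd h Nat.not_prime_one) ?_ n hn v hv).trans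
    (forall_congr' fun ℓ => forall_congr' fun _ => by simp only [not_not])
  · intro ℓ hℓ hs u hu
    have h' : ℓ = 7 ∨ ℓ % 7 = 1 ∨ ℓ % 7 = 2 ∨ ℓ % 7 = 4 := by
      by_cases h0 : ℓ % 7 = 0
      · left
        rcases (Nat.dvd_prime hℓ).1 (Nat.dvd_of_mod_eq_zero h0) with h' | h' <;> omega
      · right; omega
    exact zeta7_mk_prime_eq_split hR hℓ h' u (by rw [hu, map_natCast])
  · intro ℓ hℓ hs _ w hw u hu
    exact zeta7_mk_prime_mul_ne_split hR hℓ (not_not.mp hs) w hw u hu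

/-- **`ℚ(ζ₇)`: `[n₁] = [n₂] ⟺ every prime `ℓ ≡ 3, 5, 6 (mod 7)` occurs in `n₁`, `n₂` with exponents of the same parity.**
[cite: Deligne1982HodgeCycles, §4 p. 30 (1) and Cor. 4.2] [cite: Landherr1936HermitianForms] -/
theorem zeta7_natCast_mk_eq_mk_iff {n₁ n₂ : ℕ} (hn₁ : 1 ≤ n₁) (hn₂ : 1 ≤ n₂) (u v : (realField R)ˣ)
    (hu : (u : realField R) = n₁) (hv : (v : realField R) = n₂) :
    (QuotientGroup.mk u : cmNormResidueGroup R) = QuotientGroup.mk v ↔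
      ∀ ℓ : ℕ, ℓ.Prime → (ℓ % 7 = 3 ∨ ℓ % 7 = 5 ∨ ℓ % 7 = 6) →
        (Even (n₁.factorization ℓ) ↔ Even (n₂.factorization ℓ)) := by
  refine (natCast_mk_eq_mk_iff_even (fun ℓ => ¬ (ℓ % 7 = 3 ∨ ℓ % 7 = 5 ∨ ℓ % 7 = 6)) 1 ?_
    (fun h => absurd h Nat.not_prime_one) ?_ hn₁ hn₂ u v hu hv).trans
    (forall_congr' fun ℓ => forall_congr' fun _ => by simp only [not_not])
  · intro ℓ hℓ hs u hu
    have h' : ℓ = 7 ∨ ℓ % 7 = 1 ∨ ℓ % 7 = 2 ∨ ℓ % 7 = 4 := by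
      by_cases h0 : ℓ % 7 = 0
      · left
        rcases (Nat.dvd_prime hℓ).1 (Nat.dvd_of_mod_eq_zero h0) with h' | h' <;> omega
      · right; omega
    exact zeta7_mk_prime_eq_split hR hℓ h' u (by rw [hu, map_natCast])
  · intro ℓ hℓ hs _ w hw u hu
    exact zeta7_mk_prime_mul_ne_split hR hℓ (not_not.mp hs) w hw u hu

end Zeta7

/-! ### §2 `E = ℚ(ζ₉) ⊇ K = ℚ(√−3)`: `R = S³ + 6S² + 9S + 3` -/

section Zeta9

variable {R : Polynomial ℤ} (hR : R = X ^ 3 + C 6 * X ^ 2 + C 9 * X + C 3) [Fact (Irreducible (realPolyQ R))]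
  [Fact (Irreducible (cmPolyQ R))]
include hR

/-- **`ℚ(ζ₉)`: `[n] = [1] ⟺ every prime `ℓ ≡ 2 (mod 3)` divides `n` to an even power** (`n ≥ 1`; `t = σ + 3`,
part X-AB). Table b03.23: `[3] = [1]`; `[2], [5], [11], [17], [34] ≠ [1]`, `[4] = [1]` — instances.
[cite: Deligne1982HodgeCycles, §4 p. 30 (1) and Cor. 4.2] [cite: Landherr1936HermitianForms] -/
theorem zeta9_natCast_eq_split_iff (n : ℕ) (hn : 1 ≤ n) (v : (realField R)ˣ) (hv : (v : realField R) = n) :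
    (QuotientGroup.mk v : cmNormResidueGroup R) = splitDiscriminantClassCM R 2 ↔
      ∀ ℓ : ℕ, ℓ.Prime → ℓ % 3 = 2 → Even (n.factorization ℓ) := by
  have hodd : Odd R.natDegree := by rw [(monic_and_natDegree_of_cubic R hR).2]; exact ⟨1, rfl⟩
  exact natCast_eq_split_iff_of_neg_three hodd _ (zeta9_root_mul_sq_eq_neg_three hR) n hn v hv

/-- **`ℚ(ζ₉)`: `[n₁] = [n₂] ⟺ every prime `ℓ ≡ 2 (mod 3)` occurs in `n₁`, `n₂` with exponents of the same parity.**
[cite: Deligne1982HodgeCycles, §4 p. 30 (1) and Cor. 4.2] [cite: Landherr1936HermitianForms] -/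
theorem zeta9_natCast_mk_eq_mk_iff {n₁ n₂ : ℕ} (hn₁ : 1 ≤ n₁) (hn₂ : 1 ≤ n₂) (u v : (realField R)ˣ)
    (hu : (u : realField R) = n₁) (hv : (v : realField R) = n₂) :
    (QuotientGroup.mk u : cmNormResidueGroup R) = QuotientGroup.mk v ↔
      ∀ ℓ : ℕ, ℓ.Prime → ℓ % 3 = 2 → (Even (n₁.factorization ℓ) ↔ Even (n₂.factorization ℓ)) := by
  have hodd : Odd R.natDegree := by rw [(monic_and_natDegree_of_cubic R hR).2]; exact ⟨1, rfl⟩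
  exact natCast_mk_eq_mk_iff_of_neg_three hodd _ (zeta9_root_mul_sq_eq_neg_three hR) hn₁ hn₂ u v hu hv

end Zeta9

/-! ### §3 The composite carriers `ℚ(ζ₇)⁺(i)` (`R₂₈ = S³ + 5S² + 6S + 1`) and `ℚ(ζ₉)⁺(i)` (`R₃₆ = S³ + 6S² + 9S + 1`) -/

section R28

variable {R : Polynomial ℤ} (hR : R = X ^ 3 + C 5 * X ^ 2 + C 6 * X + C 1) [Fact (Irreducible (realPolyQ R))]
  [Fact (Irreducible (cmPolyQ R))]
include hR

/-- **`ℚ(ζ₇)⁺(i)`: `[n] = [1] ⟺ every prime `ℓ ≡ 3 (mod 4)` divides `n` to an even power** (`n ≥ 1`; `t` of part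
X-AE). Table b03.23: `[7], [3], [21] ≠ [1]` — instances. [cite: Deligne1982HodgeCycles, §4 p. 30 (1) and Cor. 4.2] -/
theorem R28_natCast_eq_split_iff (n : ℕ) (hn : 1 ≤ n) (v : (realField R)ˣ) (hv : (v : realField R) = n) :
    (QuotientGroup.mk v : cmNormResidueGroup R) = splitDiscriminantClassCM R 2 ↔
      ∀ ℓ : ℕ, ℓ.Prime → ℓ % 4 = 3 → Even (n.factorization ℓ) := by
  have hodd : Odd R.natDegree := by rw [(monic_and_natDegree_of_cubic R hR).2]; exact ⟨1, rfl⟩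
  exact natCast_eq_split_iff_of_neg_one hodd _ (R28_root_mul_sq_eq_neg_one hR) n hn v hv

/-- **`ℚ(ζ₇)⁺(i)`: `[n₁] = [n₂] ⟺ equal parities at every prime `ℓ ≡ 3 (mod 4)`.**
[cite: Deligne1982HodgeCycles, §4 p. 30 (1) and Cor. 4.2] -/
theorem R28_natCast_mk_eq_mk_iff {n₁ n₂ : ℕ} (hn₁ : 1 ≤ n₁) (hn₂ : 1 ≤ n₂) (u v : (realField R)ˣ)
    (hu : (u : realField R) = n₁) (hv : (v : realField R) = n₂) :
    (QuotientGroup.mk u : cmNormResidueGroup R) = QuotientGroup.mk v ↔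
      ∀ ℓ : ℕ, ℓ.Prime → ℓ % 4 = 3 → (Even (n₁.factorization ℓ) ↔ Even (n₂.factorization ℓ)) := by
  have hodd : Odd R.natDegree := by rw [(monic_and_natDegree_of_cubic R hR).2]; exact ⟨1, rfl⟩
  exact natCast_mk_eq_mk_iff_of_neg_one hodd _ (R28_root_mul_sq_eq_neg_one hR) hn₁ hn₂ u v hu hv

end R28

section R36

variable {R : Polynomial ℤ} (hR : R = X ^ 3 + C 6 * X ^ 2 + C 9 * X + C 1) [Fact (Irreducible (realPolyQ R))]
  [Fact (Irreducible (cmPolyQ R))]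
include hR

/-- **`ℚ(ζ₉)⁺(i)`: `[n] = [1] ⟺ every prime `ℓ ≡ 3 (mod 4)` divides `n` to an even power** (`n ≥ 1`).
Table b03.23: `[3], [19], [57] ≠ [1]` — instances. [cite: Deligne1982HodgeCycles, §4 p. 30 (1) and Cor. 4.2] -/
theorem R36_natCast_eq_split_iff (n : ℕ) (hn : 1 ≤ n) (v : (realField R)ˣ) (hv : (v : realField R) = n) :
    (QuotientGroup.mk v : cmNormResidueGroup R) = splitDiscriminantClassCM R 2 ↔
      ∀ ℓ : ℕ, ℓ.Prime → ℓ % 4 = 3 → Even (n.factorization ℓ) := by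
  have hodd : Odd R.natDegree := by rw [(monic_and_natDegree_of_cubic R hR).2]; exact ⟨1, rfl⟩
  exact natCast_eq_split_iff_of_neg_one hodd _ (R36_root_mul_sq_eq_neg_one hR) n hn v hv

/-- **`ℚ(ζ₉)⁺(i)`: `[n₁] = [n₂] ⟺ equal parities at every prime `ℓ ≡ 3 (mod 4)`.**
[cite: Deligne1982HodgeCycles, §4 p. 30 (1) and Cor. 4.2] -/
theorem R36_natCast_mk_eq_mk_iff {n₁ n₂ : ℕ} (hn₁ : 1 ≤ n₁) (hn₂ : 1 ≤ n₂) (u v : (realField R)ˣ)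
    (hu : (u : realField R) = n₁) (hv : (v : realField R) = n₂) :
    (QuotientGroup.mk u : cmNormResidueGroup R) = QuotientGroup.mk v ↔
      ∀ ℓ : ℕ, ℓ.Prime → ℓ % 4 = 3 → (Even (n₁.factorization ℓ) ↔ Even (n₂.factorization ℓ)) := by
  have hodd : Odd R.natDegree := by rw [(monic_and_natDegree_of_cubic R hR).2]; exact ⟨1, rfl⟩
  exact natCast_mk_eq_mk_iff_of_neg_one hodd _ (R36_root_mul_sq_eq_neg_one hR) hn₁ hn₂ u v hu hv

end R36

/-! ### §4 Instance-free packaging on the literal carriers -/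

/-- **The integer rows of the four sextic tables `ℚ(ζ₇)`, `ℚ(ζ₉)`, `ℚ(ζ₇)⁺(i)`, `ℚ(ζ₉)⁺(i)`, unconditionally** (literal
carriers; field instances from parts X-V / X-AE): for every `n ≥ 1` and every unit `v = n` of `F`, `[n] = [(−1)²]` iff
every prime inert in `K` (`ℓ ≡ 3,5,6 (7)`; `ℓ ≡ 2 (3)`; `ℓ ≡ 3 (4)`; `ℓ ≡ 3 (4)`) divides `n` to an even power.
[cite: Deligne1982HodgeCycles, §4 p. 30 (1) and Cor. 4.2] [cite: Landherr1936HermitianForms] -/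
theorem sextic_census_fields_integer_classification (n : ℕ) (hn : 1 ≤ n) :
    (haveI := zeta7_fact_realPolyQ
     haveI := zeta7_fact_cmPolyQ
     ∀ v : (realField (X ^ 3 + C 7 * X ^ 2 + C 14 * X + C 7 : Polynomial ℤ))ˣ,
      (v : realField (X ^ 3 + C 7 * X ^ 2 + C 14 * X + C 7 : Polynomial ℤ)) = n →
      ((QuotientGroup.mk v : cmNormResidueGroup (X ^ 3 + C 7 * X ^ 2 + C 14 * X + C 7 : Polynomial ℤ)) =
          splitDiscriminantClassCM (X ^ 3 + C 7 * X ^ 2 + C 14 * X + C 7 : Polynomial ℤ) 2 ↔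
        ∀ ℓ : ℕ, ℓ.Prime → (ℓ % 7 = 3 ∨ ℓ % 7 = 5 ∨ ℓ % 7 = 6) → Even (n.factorization ℓ))) ∧
    (haveI := zeta9_fact_realPolyQ
     haveI := zeta9_fact_cmPolyQ
     ∀ v : (realField (X ^ 3 + C 6 * X ^ 2 + C 9 * X + C 3 : Polynomial ℤ))ˣ,
      (v : realField (X ^ 3 + C 6 * X ^ 2 + C 9 * X + C 3 : Polynomial ℤ)) = n →
      ((QuotientGroup.mk v : cmNormResidueGroup (X ^ 3 + C 6 * X ^ 2 + C 9 * X + C 3 : Polynomial ℤ)) =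
          splitDiscriminantClassCM (X ^ 3 + C 6 * X ^ 2 + C 9 * X + C 3 : Polynomial ℤ) 2 ↔
        ∀ ℓ : ℕ, ℓ.Prime → ℓ % 3 = 2 → Even (n.factorization ℓ))) ∧
    (haveI := R28_fact_realPolyQ
     haveI := R28_fact_cmPolyQ
     ∀ v : (realField (X ^ 3 + C 5 * X ^ 2 + C 6 * X + C 1 : Polynomial ℤ))ˣ,
      (v : realField (X ^ 3 + C 5 * X ^ 2 + C 6 * X + C 1 : Polynomial ℤ)) = n →
      ((QuotientGroup.mk v : cmNormResidueGroup (X ^ 3 + C 5 * X ^ 2 + C 6 * X + C 1 : Polynomial ℤ)) =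
          splitDiscriminantClassCM (X ^ 3 + C 5 * X ^ 2 + C 6 * X + C 1 : Polynomial ℤ) 2 ↔
        ∀ ℓ : ℕ, ℓ.Prime → ℓ % 4 = 3 → Even (n.factorization ℓ))) ∧
    (haveI := R36_fact_realPolyQ
     haveI := R36_fact_cmPolyQ
     ∀ v : (realField (X ^ 3 + C 6 * X ^ 2 + C 9 * X + C 1 : Polynomial ℤ))ˣ,
      (v : realField (X ^ 3 + C 6 * X ^ 2 + C 9 * X + C 1 : Polynomial ℤ)) = n →
      ((QuotientGroup.mk v : cmNormResidueGroup (X ^ 3 + C 6 * X ^ 2 + C 9 * X + C 1 : Polynomial ℤ)) =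
          splitDiscriminantClassCM (X ^ 3 + C 6 * X ^ 2 + C 9 * X + C 1 : Polynomial ℤ) 2 ↔
        ∀ ℓ : ℕ, ℓ.Prime → ℓ % 4 = 3 → Even (n.factorization ℓ))) := by
  refine ⟨?_, ?_, ?_, ?_⟩
  · haveI := zeta7_fact_realPolyQ
    haveI := zeta7_fact_cmPolyQ
    exact fun v hv => zeta7_natCast_eq_split_iff rfl n hn v hv
  · haveI := zeta9_fact_realPolyQ
    haveI := zeta9_fact_cmPolyQ
    exact fun v hv => zeta9_natCast_eq_split_iff rfl n hn v hv
  · haveI := R28_fact_realPolyQ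
    haveI := R28_fact_cmPolyQ
    exact fun v hv => R28_natCast_eq_split_iff rfl n hn v hv
  · haveI := R36_fact_realPolyQ
    haveI := R36_fact_cmPolyQ
    exact fun v hv => R36_natCast_eq_split_iff rfl n hn v hv

end Summit.HodgeConjecture.HodgeConjecture.Ring2.WeilCoverageCM

end
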